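import Mathlib
import Summits.KontsevichZagierPeriods.KontsevichZagierPeriods.Theorems.SoloInformedBandLemma
import Summits.KontsevichZagierPeriods.KontsevichZagierPeriods.Theorems.SoloInformedAlgGerm
import HarnessLib
import HarnessLib.Audit

/-!
# SoloInformed — RATIONAL BAND DATA (PRES-RAT(2), Phase IV-1)

Solo programme `solo-KontsevichZagierPeriods-informed`, session s110.  The BAND LEMMA
(`SoloInformedBandData.presentable_band`) takes abstract band data.  Here we construct the band
data of the PRES-RAT(2) leaves: the integrand germ is a `K`-rational function `N/D`
(`K ⊆ ℝ` a field of real algebraic numbers, complexified through `soloInformedKToC`), and the two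
boundary germs `A`, `B` are IMPLICIT BRANCHES of nonzero `K`-polynomials `H₁`, `H₂`
(`H₁(z, A z) = 0`, `H₂(z, B z) = 0` on a complex neighbourhood `V` of `[0,1]`), e.g. the branch
delivered by `soloInformed_exists_cxImplicit`, or a `K`-constant.

Main points.
* `soloInformed_algOn_of_implicit` — an implicit branch of a nonzero `K`-polynomial is an
  algebraic function over `ℚ(z₁, z₂)` (`SoloInformedAlgOn`): if `H ∣ P^K` with `0 ≠ P ∈ ℚ[x, w]`
  (`MvPolynomial.exists_dvd_map_of_isAlgebraic`, `K/ℚ` algebraic) then `P(z, A z) = 0`.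
* `soloInformedRatBandData` — the band data with `F = N/D` on `W = {D ≠ 0}`; its algebraicity
  field is discharged by the closure properties of `SoloInformedAlgOn` (`SoloInformedFnAlg`).
* `soloInformed_presentable_ratBand` — **RATIONAL BAND THEOREM**: an integral representation with
  domain the band `{0 < x < 1, Re A(x) < y < Re B(x)}` and integrand `N/D`, `D ≠ 0` on the
  straightened closed square, is presentable.
* `K`-constant boundaries (`soloInformed_evalC_X_sub_C`, `soloInformed_X_sub_C_ne_zero`).

References: Kontsevich–Zagier 2001 §1.2; Bochnak–Coste–Roy 1998 §2.2, Prop. 8.1.8 (Nash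
functions and implicit branches); folklore.
-/

noncomputable section

open scoped BigOperators Topology
open MeasureTheory Set Filter Metric
open Literature.NumberTheory.Transcendental Literature.NumberTheory.Transcendental.KZ
open Literature.ModelTheory.ExponentialFields (IsSemialgebraic)

namespace Summit.KontsevichZagierPeriods.KontsevichZagierPeriods.Theorems

variable {K : Type*} [Field K] [Algebra K ℝ]

/-! ### The coefficient embedding: algebraic, real values -/

/-- The values of `soloInformedKToC` are algebraic over `ℚ` when `K` consists of real algebraic
numbers. -/
theorem soloInformed_isAlgebraic_kToC (hK : ∀ c : K, IsAlgebraic ℚ (algebraMap K ℝ c)) (c : K) :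
    IsAlgebraic ℚ (soloInformedKToC K c) := by
  have h := (hK c).algebraMap (A := ℂ)
  rw [Complex.coe_algebraMap] at h
  rw [soloInformedKToC_apply]
  exact h

/-- The values of `soloInformedKToC` are real. -/
theorem soloInformed_kToC_im (c : K) : (soloInformedKToC K c).im = 0 := by
  rw [soloInformedKToC_apply, Complex.ofReal_im]

/-- Evaluating the image of a `ℚ`-polynomial through `soloInformedKToC` is its `ℚ`-evaluation
(ring maps out of `ℚ` are unique). -/
theorem soloInformed_eval₂_kToC_map_rat [CharZero K] {m : ℕ} (P : MvPolynomial (Fin m) ℚ)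
    (v : Fin m → ℂ) :
    MvPolynomial.eval₂ (soloInformedKToC K) v (MvPolynomial.map (algebraMap ℚ K) P) =
      MvPolynomial.aeval v P := by
  rw [MvPolynomial.eval₂_map, MvPolynomial.aeval_def,
    Subsingleton.elim ((soloInformedKToC K).comp (algebraMap ℚ K)) (algebraMap ℚ ℂ)]

/-! ### Implicit branches of `K`-polynomials are algebraic functions -/

/-- Reindexing `(x, w) ↦ (z₁, T)`: the variables `0 ↦ 0`, `1 ↦ 2` of `Fin 3`. -/
theorem soloInformed_snoc_comp_zero_two (z : Fin 2 → ℂ) (w : ℂ) :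
    (Fin.snoc z w : Fin 3 → ℂ) ∘ ![(0 : Fin 3), 2] = ![z 0, w] := by
  funext i
  fin_cases i
  · rfl
  · rfl

/-- **Implicit branches are algebraic.**  If `H ∈ K[x, w]` is nonzero and `H^ℂ(z, A z) = 0` for
`z ∈ V`, then `z ↦ A(z₁)` is algebraic over `ℚ(z₁, z₂)` on `{z | z₁ ∈ V}`: with
`0 ≠ P ∈ ℚ[x, w]`, `H ∣ P^K`, the polynomial `P(z₁, T) ∈ ℚ[z₁, z₂][T]` kills `A(z₁)`.
[cite: BochnakCosteRoy1998, Prop. 8.1.8] -/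
theorem soloInformed_algOn_of_implicit [CharZero K]
    (hK : ∀ c : K, IsAlgebraic ℚ (algebraMap K ℝ c)) {H : MvPolynomial (Fin 2) K} (hH : H ≠ 0)
    {V : Set ℂ} {A : ℂ → ℂ}
    (hA : ∀ z ∈ V, soloInformedEvalC (soloInformedKToC K) H z (A z) = 0) :
    SoloInformedAlgOn {z : Fin 2 → ℂ | z 0 ∈ V} (fun z => A (z 0)) := by
  haveI : Algebra.IsAlgebraic ℚ K := soloInformed_isAlgebraic_of_embedding hK
  obtain ⟨P₀, hP₀, R, hR⟩ := MvPolynomial.exists_dvd_map_of_isAlgebraic (R := ℚ) hH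
  have hθ : Function.Injective ![(0 : Fin 3), 2] := by decide
  refine ⟨MvPolynomial.rename ![(0 : Fin 3), 2] P₀, fun h => hP₀ ?_, fun z hz => ?_⟩
  · exact MvPolynomial.rename_injective _ hθ (by rw [h, map_zero])
  · rw [MvPolynomial.aeval_rename, soloInformed_snoc_comp_zero_two,
      ← soloInformed_eval₂_kToC_map_rat (K := K) P₀, hR, MvPolynomial.eval₂_mul]
    have h0 : MvPolynomial.eval₂ (soloInformedKToC K) ![z 0, A (z 0)] H = 0 := hA _ hz
    rw [h0, zero_mul]

/-! ### `K`-constant boundaries -/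

/-- The constant `c ∈ K` is the implicit branch of `w − c`. -/
theorem soloInformed_evalC_X_sub_C (c : K) (z : ℂ) :
    soloInformedEvalC (soloInformedKToC K) (MvPolynomial.X 1 - MvPolynomial.C c) z
      (soloInformedKToC K c) = 0 := by
  unfold soloInformedEvalC
  rw [MvPolynomial.eval₂_sub, MvPolynomial.eval₂_X, MvPolynomial.eval₂_C]
  simp

omit [Algebra K ℝ] in
/-- `w − c ≠ 0` in `K[x, w]`. -/
theorem soloInformed_X_sub_C_ne_zero (c : K) :
    (MvPolynomial.X (1 : Fin 2) - MvPolynomial.C c : MvPolynomial (Fin 2) K) ≠ 0 := by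
  intro h
  have h1 := congr_arg (MvPolynomial.eval ![(0 : K), c + 1]) h
  rw [map_sub, MvPolynomial.eval_X, MvPolynomial.eval_C, map_zero] at h1
  simp at h1

/-- A `K`-constant is a `ℚ`-semialgebraic function of the base variable. -/
theorem soloInformed_isSemialgebraicFunOn_constK
    (hK : ∀ c : K, IsAlgebraic ℚ (algebraMap K ℝ c)) (c : K) {s : Set (Fin 1 → ℝ)}
    (hs : IsSemialgebraic ℚ s) :
    IsSemialgebraicFunOn ℚ s (fun _ => ((soloInformedKToC K c : ℂ)).re) := by
  have h : (fun _ : Fin 1 → ℝ => ((soloInformedKToC K c : ℂ)).re) = fun _ => algebraMap K ℝ c :=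
    funext fun _ => by rw [soloInformedKToC_apply, Complex.ofReal_re]
  rw [h]
  exact isSemialgebraicFunOn_const_of_isAlgebraic hs (hK c)

/-! ### The complexified rational integrand -/

/-- The open set `{D^ℂ ≠ 0} ⊆ ℂ²`. [this work] -/
def soloInformedDenSet (D : MvPolynomial (Fin 2) K) : Set (Fin 2 → ℂ) :=
  {p | MvPolynomial.eval₂ (soloInformedKToC K) p D ≠ 0}

/-- `{D^ℂ ≠ 0}` is open. -/
theorem soloInformed_isOpen_denSet (D : MvPolynomial (Fin 2) K) : IsOpen (soloInformedDenSet D) := by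
  have hc : Continuous fun p : Fin 2 → ℂ => MvPolynomial.eval₂ (soloInformedKToC K) p D :=
    continuousOn_univ.1 (soloInformed_analyticOnNhd_eval₂K D).continuousOn
  exact isOpen_ne_fun hc continuous_const

/-- The complexified rational function `N^ℂ/D^ℂ`. [this work] -/
def soloInformedRatC (N D : MvPolynomial (Fin 2) K) (p : Fin 2 → ℂ) : ℂ :=
  MvPolynomial.eval₂ (soloInformedKToC K) p N / MvPolynomial.eval₂ (soloInformedKToC K) p D

/-- `N^ℂ/D^ℂ` is analytic off `{D^ℂ = 0}`. -/
theorem soloInformed_analyticOnNhd_ratC (N D : MvPolynomial (Fin 2) K) :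
    AnalyticOnNhd ℂ (soloInformedRatC N D) (soloInformedDenSet D) := fun p hp =>
  ((soloInformed_analyticOnNhd_eval₂K N) p trivial).div
    ((soloInformed_analyticOnNhd_eval₂K D) p trivial) hp

/-- Real points: `(N/D)^ℂ(ι y) = (N(y)/D(y) : ℝ)`. -/
theorem soloInformed_ratC_toC (N D : MvPolynomial (Fin 2) K) (y : Fin 2 → ℝ) :
    soloInformedRatC N D (soloInformedToC 2 y) =
      (((MvPolynomial.aeval y N : ℝ) / MvPolynomial.aeval y D : ℝ) : ℂ) := by
  rw [Complex.ofReal_div, soloInformed_ofReal_aevalK, soloInformed_ofReal_aevalK]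
  rfl

/-- `(N/D)^ℂ` is real on real points. -/
theorem soloInformed_ratC_toC_im (N D : MvPolynomial (Fin 2) K) (y : Fin 2 → ℝ) :
    (soloInformedRatC N D (soloInformedToC 2 y)).im = 0 := by
  rw [soloInformed_ratC_toC, Complex.ofReal_im]

/-! ### Rational band data -/

/-- **Algebraicity of the rational band germ.**  With implicit branches `A`, `B` of nonzero
`K`-polynomials and `F = N/D`, the composite `z ↦ F(z₁, A z₁ + z₂ (B z₁ − A z₁)) (B z₁ − A z₁)`
is algebraic over `ℚ(z₁, z₂)` on the band-germ domain. -/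
theorem soloInformed_algOn_ratBandFn [CharZero K]
    (hK : ∀ c : K, IsAlgebraic ℚ (algebraMap K ℝ c)) (N D H₁ H₂ : MvPolynomial (Fin 2) K)
    {A B : ℂ → ℂ} {V : Set ℂ} (hH₁ : H₁ ≠ 0)
    (hA0 : ∀ z ∈ V, soloInformedEvalC (soloInformedKToC K) H₁ z (A z) = 0) (hH₂ : H₂ ≠ 0)
    (hB0 : ∀ z ∈ V, soloInformedEvalC (soloInformedKToC K) H₂ z (B z) = 0) :
    SoloInformedAlgOn (soloInformedBandSet A B V (soloInformedDenSet D))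
      (soloInformedBandFn A B (soloInformedRatC N D)) := by
  set U := soloInformedBandSet A B V (soloInformedDenSet D) with hU
  have hf := soloInformed_isAlgebraic_kToC hK
  have hUV : U ⊆ {z : Fin 2 → ℂ | z 0 ∈ V} := fun z hz => hz.1
  have hA' : SoloInformedAlgOn U (fun z => A (z 0)) :=
    (soloInformed_algOn_of_implicit hK hH₁ hA0).mono hUV
  have hB' : SoloInformedAlgOn U (fun z => B (z 0)) :=
    (soloInformed_algOn_of_implicit hK hH₂ hB0).mono hUV
  have hY : SoloInformedAlgOn U (soloInformedBandY A B) :=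
    hA'.add ((soloInformedAlgOn_coord U 1).mul (hB'.sub hA'))
  have hγ : ∀ j : Fin 2, SoloInformedAlgOn U (fun z => soloInformedBandPt A B z j) := by
    intro j
    fin_cases j
    · exact soloInformedAlgOn_coord U 0
    · exact hY
  have hN := SoloInformedAlgOn.eval₂ (soloInformedKToC K) hf U hγ N
  have hD' := SoloInformedAlgOn.eval₂ (soloInformedKToC K) hf U hγ D
  have h0 : ∀ z ∈ U,
      MvPolynomial.eval₂ (soloInformedKToC K) (fun j => soloInformedBandPt A B z j) D ≠ 0 :=
    fun z hz => hz.2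
  exact (hN.div hD' h0).mul (hB'.sub hA')

/-- **Rational band data.**  Boundary germs `A`, `B`: implicit branches of nonzero
`K`-polynomials `H₁`, `H₂` on an open `V ⊇ [0,1]`, analytic and real on reals; integrand germ
`N/D` with `D ≠ 0` on the straightened closed square. [this work] -/
def soloInformedRatBandData [CharZero K]
    (hK : ∀ c : K, IsAlgebraic ℚ (algebraMap K ℝ c)) (N D H₁ H₂ : MvPolynomial (Fin 2) K)
    (A B : ℂ → ℂ) (V : Set ℂ) (hV : IsOpen V) (hVI : ∀ x : ℝ, x ∈ Icc (0 : ℝ) 1 → (x : ℂ) ∈ V)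
    (hA : AnalyticOnNhd ℂ A V) (hB : AnalyticOnNhd ℂ B V)
    (hAr : ∀ x : ℝ, (x : ℂ) ∈ V → (A x).im = 0) (hBr : ∀ x : ℝ, (x : ℂ) ∈ V → (B x).im = 0)
    (hH₁ : H₁ ≠ 0) (hA0 : ∀ z ∈ V, soloInformedEvalC (soloInformedKToC K) H₁ z (A z) = 0)
    (hH₂ : H₂ ≠ 0) (hB0 : ∀ z ∈ V, soloInformedEvalC (soloInformedKToC K) H₂ z (B z) = 0)
    (hD : ∀ y ∈ soloInformedCube 2, MvPolynomial.eval₂ (soloInformedKToC K)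
      (soloInformedBandPt A B (soloInformedToC 2 y)) D ≠ 0) :
    SoloInformedBandData where
  A := A
  B := B
  V := V
  F := soloInformedRatC N D
  W := soloInformedDenSet D
  isOpen_V := hV
  isOpen_W := soloInformed_isOpen_denSet D
  mem_V := hVI
  analyticA := hA
  analyticB := hB
  realA := hAr
  realB := hBr
  analyticF := soloInformed_analyticOnNhd_ratC N D
  realF := fun y _ => soloInformed_ratC_toC_im N D y
  mem_W := hD
  alg := soloInformed_algOn_ratBandFn hK N D H₁ H₂ hH₁ hA0 hH₂ hB0

/-- **RATIONAL BAND THEOREM.**  Let `A`, `B` be implicit branches of nonzero `K`-polynomials on an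
open `V ⊇ [0,1]`, analytic and real on reals, with `Re A < Re B` on `(0,1)` and `Re A`, `Re B`
`ℚ`-semialgebraic on `(0,1)`; let `N/D` be `K`-rational with `D ≠ 0` on the straightened closed
square.  Then every integral representation with domain the band
`{0 < x < 1, Re A(x) < y < Re B(x)}` and integrand `N/D` is presentable. [this work] -/
theorem soloInformed_presentable_ratBand [CharZero K]
    (hK : ∀ c : K, IsAlgebraic ℚ (algebraMap K ℝ c)) (N D H₁ H₂ : MvPolynomial (Fin 2) K)
    (A B : ℂ → ℂ) (V : Set ℂ) (hV : IsOpen V) (hVI : ∀ x : ℝ, x ∈ Icc (0 : ℝ) 1 → (x : ℂ) ∈ V)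
    (hA : AnalyticOnNhd ℂ A V) (hB : AnalyticOnNhd ℂ B V)
    (hAr : ∀ x : ℝ, (x : ℂ) ∈ V → (A x).im = 0) (hBr : ∀ x : ℝ, (x : ℂ) ∈ V → (B x).im = 0)
    (hH₁ : H₁ ≠ 0) (hA0 : ∀ z ∈ V, soloInformedEvalC (soloInformedKToC K) H₁ z (A z) = 0)
    (hH₂ : H₂ ≠ 0) (hB0 : ∀ z ∈ V, soloInformedEvalC (soloInformedKToC K) H₂ z (B z) = 0)
    (hD : ∀ y ∈ soloInformedCube 2, MvPolynomial.eval₂ (soloInformedKToC K)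
      (soloInformedBandPt A B (soloInformedToC 2 y)) D ≠ 0)
    (hlt : ∀ s : ℝ, 0 < s → s < 1 → (A s).re < (B s).re)
    (has : IsSemialgebraicFunOn ℚ (soloInformedOpenCube 1) (fun x => (A (x 0)).re))
    (hbs : IsSemialgebraicFunOn ℚ (soloInformedOpenCube 1) (fun x => (B (x 0)).re))
    (r : IntegralRep 2)
    (hdom : r.domain = soloInformedBand (fun s => (A s).re) (fun s => (B s).re))
    (hint : EqOn r.integrand
      (fun y => (MvPolynomial.aeval y N : ℝ) / MvPolynomial.aeval y D) r.domain) :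
    of r ∈ soloInformedPresentable :=
  (soloInformedRatBandData hK N D H₁ H₂ A B V hV hVI hA hB hAr hBr hH₁ hA0 hH₂ hB0
    hD).presentable_band hlt has hbs r hdom fun y hy => by
      rw [hint hy]
      exact (soloInformed_ratC_toC N D y).symm

end Summit.KontsevichZagierPeriods.KontsevichZagierPeriods.Theorems
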